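import Summits.QuantumFields.YangMills.Theorems.SwapTwistDeficitPeriodicRingFloorCommBox
import Summits.QuantumFields.YangMills.Theorems.SwapTwistDeficitPeriodicRingFloorBoxMass
import HarnessLib

/-!
# The product-Haar mass of the nearly-commuting toron box with an ARBITRARY measurable event for the four leaders:
# `Haar⁴(E) · ballVol(t₂)^{6L⁴−3} ≤ μ_L{F₀ ≤ 250L⁴(t₂+s)²}` whenever `E ⊆ {pairwise ‖C_kC_l − C_lC_k‖_F ≤ s}`
# (free-hands support of item stmt-QuantumFields-24497 `ToronValleyVolume.ToronTubeVolumeLaw`, one-sided fixed-`L` half; brick (A1-ii) of the fixed-`L`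
# reduction memo of seat w2 g54 — the measure half of the LOGARITHMIC periodic floor; the leader event is supplied by the four-letter volume theorem
# of seat w2 g54's `ToronLog`)

With the four leaders of a tree-gauged ring history — the wrap links `C_μ = w(−ê_μ, μ)`, `μ < 3`, of slice `0` and the seam value `c = g 0` — read as ONE
point `Fin.snoc C c : Fin 4 → SU(2)`, and every other variable within `t₂` of its letter (✓`ringDeficit_le_of_commBox`):

* §1 `measure_leaderSet_eq` — abstract Fubini bookkeeping: on `(A₁ × A₂) × (B × (C₁ × C₂))` with a product measure, the set
  `{(a₁,c₁) ∈ F} ∩ {a₂ ∈ S_A} ∩ {b ∈ S_B} ∩ {c₂ ∈ S_C}` has measure `(μ₁ ⊗ κ₁)(F) · μ₂(S_A) · ν(S_B) · κ₂(S_C)` (the leader event couples the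
  first and the fourth factor);
* §2 ★ `pi_real_mul_ballVol_pow_le_ringMeasure_real_deficit_le` — for every measurable `E ⊆ {C : Fin 4 → SU(2) | ∀ k l, ‖C_kC_l − C_lC_k‖_F ≤ s}`,
  `(Haar⁴).real E · ballVol(t₂)^{6L⁴−3} ≤ (ringMeasure L).real {F₀ ≤ 250·L⁴·(t₂+s)²}`: the architecture of ✓`ballVol_pow_le_ringMeasure_real_deficit_le`
  (tree gauge ✓`measureReal_deficit_le_eq_fix`, letter translations as skew products) with the two leader factors identified with `Fin 4 → SU(2)` by
  `piCongrLeft` ∕ `measurePreserving_eval` ∕ `piFinSuccAbove`.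

With `E = {‖C_k − 1‖ ≤ √s/…}` this is the box floor again; with `E =` the nearly-commuting set of Haar⁴-volume `≍ s⁶ log s⁻¹` it gives the logarithm (sequel).
HONEST FRAMING: fixed-lattice Haar-measure bookkeeping for the cheap direction of a fixed-`L` Laplace asymptotic; ⟨24497⟩ (TWO-sided, `poly(L)`-uniform) is
NOT proved, nor any crux, rung or summit; the Yang–Mills mass gap is NOT proved; no summit is proved by a line.  THEOREMS ONLY (0 `def`, 0 `sorry`),
standard axioms.  Width seat ym-line-sfw-p2-w3 g61 (cell ym-idea-1, free hands), `--supports stmt-QuantumFields-24497`.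
References: [cite: Luscher1983, §2]; [cite: Vanbaal2001]; [cite: Chatterjee2016, Lemma 9.3]; [cite: GonzalezarroyoAltes1988].
-/

set_option autoImplicit false

noncomputable section

open MeasureTheory
open scoped BigOperators ENNReal
open Literature.MathematicalPhysics.QuantumFieldTheory hiding SU2
open Literature.MathematicalPhysics.QuantumLattice
open Summit.QuantumFields.YangMills.Theorems.FemtoTransferGap
open Summit.QuantumFields.YangMills.Theorems.FemtoTransferGap.TT
open Summit.QuantumFields.YangMills.Theorems.VirialFluxGap.RingDeficit
open Summit.QuantumFields.YangMills.Theorems.VirialFluxGap.TreeGaugeTransfer (measureReal_deficit_le_eq_fix)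
open Summit.QuantumFields.YangMills.Theorems.VirialFluxGap.FixSplit (card_offIdx)

namespace Summit.QuantumFields.YangMills.Theorems.SwapTwistDeficit.PeriodicRingFloor

/-! ## §1 Fubini bookkeeping for an event coupling the first and the fourth factor -/

section Fubini

variable {A₁ A₂ B C₁ C₂ : Type*} [MeasurableSpace A₁] [MeasurableSpace A₂] [MeasurableSpace B] [MeasurableSpace C₁] [MeasurableSpace C₂]

/-- **Fubini bookkeeping**: on `(A₁ × A₂) × (B × (C₁ × C₂))` with the product measure `(μ₁ ⊗ μ₂) ⊗ (ν ⊗ (κ₁ ⊗ κ₂))`, the set of points with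
`(a₁, c₁) ∈ F`, `a₂ ∈ S_A`, `b ∈ S_B`, `c₂ ∈ S_C` has measure `(μ₁ ⊗ κ₁)(F) · μ₂(S_A) · ν(S_B) · κ₂(S_C)`. [folklore] -/
theorem measure_leaderSet_eq (μ₁ : Measure A₁) (μ₂ : Measure A₂) (ν : Measure B) (κ₁ : Measure C₁) (κ₂ : Measure C₂)
    [SFinite μ₁] [SFinite μ₂] [SFinite ν] [SFinite κ₁] [SFinite κ₂]
    {F : Set (A₁ × C₁)} (hF : MeasurableSet F) {SA : Set A₂} (hSA : MeasurableSet SA) {SB : Set B} (hSB : MeasurableSet SB)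
    {SC : Set C₂} (hSC : MeasurableSet SC) :
    ((μ₁.prod μ₂).prod (ν.prod (κ₁.prod κ₂)))
        {z : (A₁ × A₂) × (B × (C₁ × C₂)) | (z.1.1, z.2.2.1) ∈ F ∧ z.1.2 ∈ SA ∧ z.2.1 ∈ SB ∧ z.2.2.2 ∈ SC} =
      (μ₁.prod κ₁) F * μ₂ SA * ν SB * κ₂ SC := by
  set T : Set ((A₁ × A₂) × (B × (C₁ × C₂))) := {z | (z.1.1, z.2.2.1) ∈ F ∧ z.1.2 ∈ SA ∧ z.2.1 ∈ SB ∧ z.2.2.2 ∈ SC} with hT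
  have hTm : MeasurableSet T := by
    have h1 : Measurable fun z : (A₁ × A₂) × (B × (C₁ × C₂)) => (z.1.1, z.2.2.1) :=
      measurable_fst.fst.prodMk measurable_snd.snd.fst
    exact ((hF.preimage h1).inter (hSA.preimage measurable_fst.snd)).inter
      ((hSB.preimage measurable_snd.fst).inter (hSC.preimage measurable_snd.snd.snd)) |>.congr
      (by ext z; simp only [hT, Set.mem_inter_iff, Set.mem_preimage, Set.mem_setOf_eq, and_assoc])
  -- the sections over `(a₁, a₂)`
  have hsec : ∀ a : A₁ × A₂, (ν.prod (κ₁.prod κ₂)) (Prod.mk a ⁻¹' T) =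
      (fun a₁ => ν SB * (κ₁ (Prod.mk a₁ ⁻¹' F) * κ₂ SC)) a.1 * SA.indicator (fun _ => (1 : ℝ≥0∞)) a.2 := by
    rintro ⟨a₁, a₂⟩
    by_cases ha : a₂ ∈ SA
    · have hset : Prod.mk (a₁, a₂) ⁻¹' T = SB ×ˢ ((Prod.mk a₁ ⁻¹' F) ×ˢ SC) := by
        ext y
        simp only [hT, Set.mem_preimage, Set.mem_setOf_eq, Set.mem_prod, ha, true_and]
        tauto
      rw [hset, Measure.prod_prod, Measure.prod_prod, Set.indicator_of_mem ha, mul_one]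
    · have hset : Prod.mk (a₁, a₂) ⁻¹' T = ∅ := by
        ext y
        simp only [hT, Set.mem_preimage, Set.mem_setOf_eq, ha, false_and, and_false, Set.mem_empty_iff_false]
      rw [hset, measure_empty, Set.indicator_of_notMem ha, mul_zero]
  have hmeasF : Measurable fun a₁ : A₁ => ν SB * (κ₁ (Prod.mk a₁ ⁻¹' F) * κ₂ SC) :=
    ((measurable_measure_prodMk_left hF).mul_const _).const_mul _
  rw [Measure.prod_apply hTm]
  simp_rw [hsec]
  rw [lintegral_prod_mul hmeasF.aemeasurable (measurable_const.indicator hSA).aemeasurable, lintegral_indicator_const hSA, one_mul,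
    lintegral_const_mul _ ((measurable_measure_prodMk_left hF).mul_const _), lintegral_mul_const _ (measurable_measure_prodMk_left hF),
    ← Measure.prod_apply hF]
  ring

end Fubini

/-! ## §2 The mass of the nearly-commuting box with a measurable leader event -/

variable {L : ℕ} [NeZero L]

/-- ★ **HAAR⁴(E) · ballVol(t₂)^{6L⁴−3} ≤ μ_L{F₀ ≤ 250·L⁴·(t₂+s)²} FOR EVERY MEASURABLE LEADER EVENT `E` OF NEARLY COMMUTING QUADRUPLES.**
For `0 ≤ t₂, s` and measurable `E ⊆ {C : Fin 4 → SU(2) | ∀ k l, ‖C_kC_l − C_lC_k‖_F ≤ s}`: the tree-gauged ring histories whose leaders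
`Fin.snoc (μ ↦ w(−ê_μ,μ)) (g 0)` lie in `E` and whose other `6L⁴ − 3` variables are within `t₂` of their letters form a set of product-Haar mass
`Haar⁴(E)·ballVol(t₂)^{6L⁴−3}` (letter translations are skew products; the two leader factors are identified with `Fin 4 → SU(2)` measure-preservingly by
`piCongrLeft`, evaluation at the seam site `0`, `piFinSuccAbove`; `measure_leaderSet_eq`), contained in `{F₀ ≤ 250L⁴(t₂+s)²}` by ✓`ringDeficit_le_of_commBox`; tree gauge
✓`measureReal_deficit_le_eq_fix`. [cite: Chatterjee2016, Lemma 9.3] [cite: Luscher1983, §2] -/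
theorem pi_real_mul_ballVol_pow_le_ringMeasure_real_deficit_le {t₂ s : ℝ} (ht₂ : 0 ≤ t₂) (hs : 0 ≤ s)
    (E : Set (Fin 4 → SU2)) (hEm : MeasurableSet E)
    (hE : E ⊆ {C : Fin 4 → SU2 | ∀ k l : Fin 4,
      frobNorm (((C k * C l : SU2) : Matrix (Fin 2) (Fin 2) ℂ) - ((C l * C k : SU2) : Matrix (Fin 2) (Fin 2) ℂ)) ≤ s}) :
    (Measure.pi fun _ : Fin 4 => haarProbability SU2).real E * ballVol t₂ ^ (6 * L ^ 4 - 3) ≤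
      (ringMeasure L).real {P | ringDeficit L (fun _ => false) P ≤ 250 * (L : ℝ) ^ 4 * (t₂ + s) ^ 2} := by
  haveI : (haarProbability SU2).IsMulLeftInvariant := by unfold haarProbability; infer_instance
  haveI : IsProbabilityMeasure (gaugeMeasure L) := isProbabilityMeasure_gaugeMeasure (L := L)
  -- the three factors of `X_fix` and their measures
  set μA : Measure (OffIdx L → SU2) := Measure.pi fun _ : OffIdx L => haarProbability SU2 with hμA
  set μB : Measure (Fin (2 * L - 1) → GaugeConfig 3 L SU2) := Measure.pi fun _ : Fin (2 * L - 1) => configMeasure SU2 L with hμB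
  set μC : Measure (Site 3 L → SU2) := gaugeMeasure L with hμC
  set π4 : Measure (Fin 4 → SU2) := Measure.pi fun _ : Fin 4 => haarProbability SU2 with hπ4
  -- the fluctuation ball
  set B₂ : Set SU2 := {W : SU2 | frobNorm ((W : Matrix (Fin 2) (Fin 2) ℂ) - 1) ≤ t₂} with hB₂
  have hB₂m : MeasurableSet B₂ := measurableSet_frobBall_one t₂
  /- (A) slice 0: leaders and letters -/
  set Lead : Fin 3 → OffIdx L := fun μ => ⟨(Pi.single μ (-1 : ZMod L), μ), leader_not_treeEdge μ⟩ with hLead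
  have hLead_inj : Function.Injective Lead := fun μ ν h => by
    have := congrArg (fun i : OffIdx L => i.1.2) h
    simpa [hLead] using this
  set pA : OffIdx L → Prop := fun i => ∃ μ, i = Lead μ with hpA
  set πA₁ : Measure ({i // pA i} → SU2) := Measure.pi fun _ => haarProbability SU2 with hπA₁
  set πA₂ : Measure ({i // ¬pA i} → SU2) := Measure.pi fun _ => haarProbability SU2 with hπA₂
  set eA := MeasurableEquiv.piEquivPiSubtypeProd (fun _ : OffIdx L => SU2) pA with heA_def
  have heA : MeasurePreserving eA μA (πA₁.prod πA₂) := measurePreserving_piEquivPiSubtypeProd (fun _ : OffIdx L => haarProbability SU2) pA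
  set cA : ({i // pA i} → SU2) → OffIdx L → SU2 := fun a i =>
    (if i.1.1 i.1.2 = -1 then a ⟨Lead i.1.2, ⟨i.1.2, rfl⟩⟩ else 1)⁻¹ with hcA
  set ΦA : ({i // pA i} → SU2) → ({i // ¬pA i} → SU2) → ({i // ¬pA i} → SU2) := fun a b i => cA a i.1 * b i with hΦA
  have hΦAa : ∀ a, MeasurePreserving (ΦA a) πA₂ πA₂ := fun a =>
    measurePreserving_pi (fun _ : {i // ¬pA i} => haarProbability SU2) (fun _ : {i // ¬pA i} => haarProbability SU2)
      fun i => measurePreserving_mul_left (haarProbability SU2) (cA a i.1)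
  have hcAm : ∀ i : OffIdx L, Measurable fun a : {i // pA i} → SU2 => cA a i := by
    intro i
    by_cases hsx : i.1.1 i.1.2 = -1
    · simp only [hcA, hsx, if_true]; exact (measurable_pi_apply _).inv
    · simp only [hcA, hsx, if_false, inv_one]; exact measurable_const
  have hΦAm : Measurable (Function.uncurry ΦA) := by
    refine measurable_pi_lambda _ fun i => ?_
    exact ((hcAm i.1).comp measurable_fst).mul ((measurable_pi_apply i).comp measurable_snd)
  set skA : ({i // pA i} → SU2) × ({i // ¬pA i} → SU2) → ({i // pA i} → SU2) × ({i // ¬pA i} → SU2) :=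
    fun z => (id z.1, ΦA z.1 z.2) with hskA
  have hskewA : MeasurePreserving skA (πA₁.prod πA₂) (πA₁.prod πA₂) :=
    (MeasurePreserving.id πA₁).skew_product hΦAm (ae_of_all _ fun a => (hΦAa a).map_eq)
  have hψA : MeasurePreserving (fun w => skA (eA w)) μA (πA₁.prod πA₂) := hskewA.comp heA
  /- (C) the seam field: leader `g 0` (an opaque copy of the predicate `x = 0`, so that `{x // pC x}` carries the generic instances) -/
  obtain ⟨pC, hpC⟩ : ∃ p : Site 3 L → Prop, ∀ x, p x ↔ x = 0 := ⟨fun x => x = 0, fun _ => Iff.rfl⟩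
  haveI hdecC : DecidablePred pC := fun x => decidable_of_iff _ (hpC x).symm
  have hp0 : pC 0 := (hpC 0).2 rfl
  set πC₁ : Measure ({x // pC x} → SU2) := Measure.pi fun _ => haarProbability SU2 with hπC₁
  set πC₂ : Measure ({x // ¬pC x} → SU2) := Measure.pi fun _ => haarProbability SU2 with hπC₂
  set eC := MeasurableEquiv.piEquivPiSubtypeProd (fun _ : Site 3 L => SU2) pC with heC_def
  have heC : MeasurePreserving eC μC (πC₁.prod πC₂) := by
    have hμC' : μC = Measure.pi fun _ : Site 3 L => haarProbability SU2 := rfl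
    rw [hμC']
    exact measurePreserving_piEquivPiSubtypeProd (fun _ : Site 3 L => haarProbability SU2) pC
  set ΦC : ({x // pC x} → SU2) → ({x // ¬pC x} → SU2) → ({x // ¬pC x} → SU2) := fun a b x => (a ⟨0, hp0⟩)⁻¹ * b x with hΦC
  have hΦCa : ∀ a, MeasurePreserving (ΦC a) πC₂ πC₂ := fun a =>
    measurePreserving_pi (fun _ : {x // ¬pC x} => haarProbability SU2) (fun _ : {x // ¬pC x} => haarProbability SU2)
      fun _ => measurePreserving_mul_left (haarProbability SU2) _
  have hΦCm : Measurable (Function.uncurry ΦC) := by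
    refine measurable_pi_lambda _ fun x => ?_
    exact ((measurable_pi_apply _).inv.comp measurable_fst).mul ((measurable_pi_apply x).comp measurable_snd)
  set skC : ({x // pC x} → SU2) × ({x // ¬pC x} → SU2) → ({x // pC x} → SU2) × ({x // ¬pC x} → SU2) :=
    fun z => (id z.1, ΦC z.1 z.2) with hskC
  have hskewC : MeasurePreserving skC (πC₁.prod πC₂) (πC₁.prod πC₂) :=
    (MeasurePreserving.id πC₁).skew_product hΦCm (ae_of_all _ fun a => (hΦCa a).map_eq)
  have hψC : MeasurePreserving (fun g => skC (eC g)) μC (πC₁.prod πC₂) := hskewC.comp heC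
  /- (B) the slices `1 … 2L−1`, translated by `glue w` -/
  set τ : (OffIdx L → SU2) → (Fin (2 * L - 1) → GaugeConfig 3 L SU2) → (Fin (2 * L - 1) → GaugeConfig 3 L SU2) :=
    fun w r j e => (glue w e)⁻¹ * r j e with hτ
  have hτw : ∀ w, MeasurePreserving (τ w) μB μB := fun w => by
    have hin : MeasurePreserving (fun (U : GaugeConfig 3 L SU2) (e : Edge 3 L) => (glue w e)⁻¹ * U e)
        (configMeasure SU2 L) (configMeasure SU2 L) := by
      unfold configMeasure
      exact measurePreserving_pi (fun _ : Edge 3 L => haarProbability SU2) (fun _ : Edge 3 L => haarProbability SU2)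
        fun e => measurePreserving_mul_left (haarProbability SU2) ((glue w e)⁻¹)
    exact measurePreserving_pi (fun _ : Fin (2 * L - 1) => configMeasure SU2 L) (fun _ : Fin (2 * L - 1) => configMeasure SU2 L)
      fun _ => hin
  set Ψ₁ : (OffIdx L → SU2) × ((Fin (2 * L - 1) → GaugeConfig 3 L SU2) × (Site 3 L → SU2)) →
      (OffIdx L → SU2) × ((Fin (2 * L - 1) → GaugeConfig 3 L SU2) × (Site 3 L → SU2)) :=
    fun x => (id x.1, (τ x.1 x.2.1, x.2.2)) with hΨ₁
  have hfibm : Measurable (Function.uncurry fun (w : OffIdx L → SU2)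
      (q : (Fin (2 * L - 1) → GaugeConfig 3 L SU2) × (Site 3 L → SU2)) => (τ w q.1, q.2)) := by
    refine Measurable.prodMk ?_ (measurable_snd.comp measurable_snd)
    refine measurable_pi_lambda _ fun j => measurable_pi_lambda _ fun e => ?_
    exact (((measurable_pi_apply e).comp (measurable_glue.comp measurable_fst)).inv).mul
      ((measurable_pi_apply e).comp ((measurable_pi_apply j).comp (measurable_fst.comp measurable_snd)))
  have hfib : ∀ w, MeasurePreserving (fun q : (Fin (2 * L - 1) → GaugeConfig 3 L SU2) × (Site 3 L → SU2) => (τ w q.1, q.2))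
      (μB.prod μC) (μB.prod μC) := fun w => (hτw w).prod (MeasurePreserving.id μC)
  have hΨ₁m : MeasurePreserving Ψ₁ (μA.prod (μB.prod μC)) (μA.prod (μB.prod μC)) :=
    (MeasurePreserving.id μA).skew_product hfibm (ae_of_all _ fun w => (hfib w).map_eq)
  set Ψ₂ : (OffIdx L → SU2) × ((Fin (2 * L - 1) → GaugeConfig 3 L SU2) × (Site 3 L → SU2)) →
      (({i // pA i} → SU2) × ({i // ¬pA i} → SU2)) ×
        ((Fin (2 * L - 1) → GaugeConfig 3 L SU2) × (({x // pC x} → SU2) × ({x // ¬pC x} → SU2))) :=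
    Prod.map (fun w => skA (eA w)) (Prod.map id fun g => skC (eC g)) with hΨ₂
  have hΨ₂m : MeasurePreserving Ψ₂ (μA.prod (μB.prod μC)) ((πA₁.prod πA₂).prod (μB.prod (πC₁.prod πC₂))) :=
    hψA.prod ((MeasurePreserving.id μB).prod hψC)
  have hΨ : MeasurePreserving (fun x => Ψ₂ (Ψ₁ x)) (μA.prod (μB.prod μC)) ((πA₁.prod πA₂).prod (μB.prod (πC₁.prod πC₂))) :=
    hΨ₂m.comp hΨ₁m
  /- (Θ) the two leader factors as one point of `Fin 4 → SU(2)` -/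
  set e3 : Fin 3 ≃ {i // pA i} := Equiv.ofBijective (fun μ => ⟨Lead μ, ⟨μ, rfl⟩⟩)
    ⟨fun μ ν h => hLead_inj (congrArg Subtype.val h), fun i => by
      obtain ⟨μ, hμ⟩ := i.2
      exact ⟨μ, Subtype.ext hμ.symm⟩⟩ with he3
  set eA1 : ({i // pA i} → SU2) ≃ᵐ (Fin 3 → SU2) := (MeasurableEquiv.piCongrLeft (fun _ : {i // pA i} => SU2) e3).symm with heA1
  have hA1 : MeasurePreserving eA1 πA₁ (Measure.pi fun _ : Fin 3 => haarProbability SU2) :=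
    MeasurePreserving.symm _ (measurePreserving_piCongrLeft (fun _ : {i // pA i} => haarProbability SU2) e3)
  set eC1 : ({x // pC x} → SU2) → SU2 := fun a => a ⟨0, hp0⟩ with heC1
  have hC1 : MeasurePreserving eC1 πC₁ (haarProbability SU2) :=
    measurePreserving_eval (fun _ : {x // pC x} => haarProbability SU2) ⟨0, hp0⟩
  set e4 := MeasurableEquiv.piFinSuccAbove (fun _ : Fin 4 => SU2) (Fin.last 3) with he4
  have h4 : MeasurePreserving e4 π4 ((haarProbability SU2).prod (Measure.pi fun _ : Fin 3 => haarProbability SU2)) :=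
    measurePreserving_piFinSuccAbove (fun _ : Fin 4 => haarProbability SU2) (Fin.last 3)
  set Θ : ({i // pA i} → SU2) × ({x // pC x} → SU2) → (Fin 4 → SU2) :=
    fun z => e4.symm (Prod.map eC1 eA1 (Prod.swap z)) with hΘ
  have hΘm : MeasurePreserving Θ (πA₁.prod πC₁) π4 :=
    ((MeasurePreserving.symm e4 h4).comp (hC1.prod hA1)).comp Measure.measurePreserving_swap
  have hΘ_cast : ∀ (z : ({i // pA i} → SU2) × ({x // pC x} → SU2)) (μ : Fin 3),
      Θ z (Fin.castSucc μ) = z.1 ⟨Lead μ, ⟨μ, rfl⟩⟩ := by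
    intro z μ
    simp only [hΘ, he4, heC1, heA1, Prod.map, Prod.swap, MeasurableEquiv.piFinSuccAbove_symm_apply, Fin.insertNthEquiv_apply,
      Fin.insertNth_last', Fin.snoc_castSucc]
    rfl
  have hΘ_last : ∀ (z : ({i // pA i} → SU2) × ({x // pC x} → SU2)), Θ z (Fin.last 3) = z.2 ⟨0, hp0⟩ := by
    intro z
    simp only [hΘ, he4, heC1, Prod.map, Prod.swap, MeasurableEquiv.piFinSuccAbove_symm_apply, Fin.insertNthEquiv_apply,
      Fin.insertNth_last', Fin.snoc_last]
  /- the target set and the toron event -/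
  set F : Set (({i // pA i} → SU2) × ({x // pC x} → SU2)) := Θ ⁻¹' E with hF
  have hFm : MeasurableSet F := hEm.preimage hΘm.measurable
  set SA : Set ({i // ¬pA i} → SU2) := Set.pi Set.univ fun _ => B₂ with hSA
  set SB : Set (Fin (2 * L - 1) → GaugeConfig 3 L SU2) := Set.pi Set.univ fun _ => Set.pi Set.univ fun _ => B₂ with hSB
  set SC : Set ({x // ¬pC x} → SU2) := Set.pi Set.univ fun _ => B₂ with hSC
  have hSAm : MeasurableSet SA := MeasurableSet.univ_pi fun _ => hB₂m
  have hSBm : MeasurableSet SB := MeasurableSet.univ_pi fun _ => MeasurableSet.univ_pi fun _ => hB₂m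
  have hSCm : MeasurableSet SC := MeasurableSet.univ_pi fun _ => hB₂m
  set T : Set ((({i // pA i} → SU2) × ({i // ¬pA i} → SU2)) ×
      ((Fin (2 * L - 1) → GaugeConfig 3 L SU2) × (({x // pC x} → SU2) × ({x // ¬pC x} → SU2)))) :=
    {z | (z.1.1, z.2.2.1) ∈ F ∧ z.1.2 ∈ SA ∧ z.2.1 ∈ SB ∧ z.2.2.2 ∈ SC} with hT
  have hTm : MeasurableSet T := by
    have h1 : Measurable fun z : (({i // pA i} → SU2) × ({i // ¬pA i} → SU2)) ×
        ((Fin (2 * L - 1) → GaugeConfig 3 L SU2) × (({x // pC x} → SU2) × ({x // ¬pC x} → SU2))) => (z.1.1, z.2.2.1) :=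
      measurable_fst.fst.prodMk measurable_snd.snd.fst
    exact ((hFm.preimage h1).inter (hSAm.preimage measurable_fst.snd)).inter
      ((hSBm.preimage measurable_snd.fst).inter (hSCm.preimage measurable_snd.snd.snd)) |>.congr
      (by ext z; simp only [hT, Set.mem_inter_iff, Set.mem_preimage, Set.mem_setOf_eq, and_assoc])
  set P : Set ((OffIdx L → SU2) × ((Fin (2 * L - 1) → GaugeConfig 3 L SU2) × (Site 3 L → SU2))) :=
    (fun x => Ψ₂ (Ψ₁ x)) ⁻¹' T with hP
  /- (1) the mass of the toron event -/
  have hcardA₁ : Fintype.card {i // pA i} = 3 := by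
    have hmem : ∀ i : OffIdx L, i ∈ Finset.univ.image Lead ↔ pA i := fun i => by
      simp only [Finset.mem_image, Finset.mem_univ, true_and]
      constructor
      · rintro ⟨μ, h⟩; exact ⟨μ, h.symm⟩
      · rintro ⟨μ, h⟩; exact ⟨μ, h.symm⟩
    rw [Fintype.card_of_subtype (Finset.univ.image Lead) hmem, Finset.card_image_of_injective _ hLead_inj, Finset.card_univ,
      Fintype.card_fin]
  have hcardA₂ : Fintype.card {i // ¬pA i} = 2 * L ^ 3 + 1 - 3 := by
    rw [Fintype.card_subtype_compl, hcardA₁, card_offIdx]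
  have hcardC₁ : Fintype.card {x // pC x} = 1 := by
    rw [Fintype.card_of_subtype ({0} : Finset (Site 3 L)) (fun x => by rw [Finset.mem_singleton]; exact (hpC x).symm),
      Finset.card_singleton]
  have hcardC₂ : Fintype.card {x // ¬pC x} = L ^ 3 - 1 := by
    rw [Fintype.card_subtype_compl, hcardC₁, TwoLattice.Electric.card_site]
  have hSBmass : μB SB = (haarProbability SU2 B₂ ^ Fintype.card (Edge 3 L)) ^ (2 * L - 1) := by
    rw [hμB, hSB, Measure.pi_pi]
    simp only [configMeasure, Measure.pi_pi, Finset.prod_const, Finset.card_univ, Fintype.card_fin]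
  have hPmass : (μA.prod (μB.prod μC)) P = π4 E * haarProbability SU2 B₂ ^ (6 * L ^ 4 - 3) := by
    have h1 : (μA.prod (μB.prod μC)) P = ((πA₁.prod πA₂).prod (μB.prod (πC₁.prod πC₂))) T :=
      hΨ.measure_preimage hTm.nullMeasurableSet
    have h2 : (πA₁.prod πC₁) F = π4 E := hΘm.measure_preimage hEm.nullMeasurableSet
    rw [h1, hT, measure_leaderSet_eq πA₁ πA₂ μB πC₁ πC₂ hFm hSAm hSBm hSCm, h2, hSBmass, hSA, hSC, hπA₂, hπC₂, Measure.pi_pi,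
      Measure.pi_pi]
    simp only [Finset.prod_const, Finset.card_univ, hcardA₂, hcardC₂, FemtoTransferGap.card_edge_three]
    rw [← card_nonleaders (L := L) NeZero.one_le]
    ring
  /- (2) on the toron event the deficit is small -/
  have hPsub : P ⊆ {x | ringDeficit L (fun _ => false)
      ((Fin.cons (glue x.1) x.2.1 : Fin (2 * L - 1 + 1) → GaugeConfig 3 L SU2), x.2.2) ≤ 250 * (L : ℝ) ^ 4 * (t₂ + s) ^ 2} := by
    rintro ⟨w, r, g⟩ hx
    have hx' : Ψ₂ (Ψ₁ (w, r, g)) ∈ T := hx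
    simp only [hT, hΨ₂, hΨ₁, Prod.map_apply, id, Set.mem_setOf_eq] at hx'
    obtain ⟨hFx, hAR, hBx, hCR⟩ := hx'
    -- the leaders: membership in `E`
    have hlead4 := hE hFx
    simp only [Set.mem_setOf_eq] at hlead4
    have hleadA : ∀ μ : Fin 3, Θ ((skA (eA w)).1, (skC (eC g)).1) (Fin.castSucc μ) = w (Lead μ) := fun μ => by
      rw [hΘ_cast]; rfl
    have hleadC : Θ ((skA (eA w)).1, (skC (eC g)).1) (Fin.last 3) = g 0 := by
      rw [hΘ_last]; rfl
    have hCC : ∀ μ ν : Fin 3, frobNorm (((w (Lead μ) * w (Lead ν) : SU2) : Matrix (Fin 2) (Fin 2) ℂ) -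
        ((w (Lead ν) * w (Lead μ) : SU2) : Matrix (Fin 2) (Fin 2) ℂ)) ≤ s := fun μ ν => by
      have h := hlead4 (Fin.castSucc μ) (Fin.castSucc ν)
      rwa [hleadA, hleadA] at h
    have hcC : ∀ μ : Fin 3, frobNorm (((g 0 * w (Lead μ) : SU2) : Matrix (Fin 2) (Fin 2) ℂ) -
        ((w (Lead μ) * g 0 : SU2) : Matrix (Fin 2) (Fin 2) ℂ)) ≤ s := fun μ => by
      have h := hlead4 (Fin.last 3) (Fin.castSucc μ)
      rwa [hleadA, hleadC] at h
    -- letters of slice 0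
    have hw : ∀ i : OffIdx L, frobNorm ((((if i.1.1 i.1.2 = -1 then w (Lead i.1.2) else 1)⁻¹ * w i : SU2) :
        Matrix (Fin 2) (Fin 2) ℂ) - 1) ≤ t₂ := by
      intro i
      by_cases hpi : pA i
      · obtain ⟨μ, hμ⟩ := hpi
        have hsx : i.1.1 i.1.2 = -1 := by rw [hμ]; simp [hLead]
        have hμ2 : i.1.2 = μ := by rw [hμ]
        rw [if_pos hsx, hμ2, ← hμ, inv_mul_cancel]
        simp [frobNorm_zero, ht₂]
      · have h := (Set.mem_univ_pi.1 hAR) ⟨i, hpi⟩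
        simp only [hskA, hΦA, hcA, heA_def, MeasurableEquiv.piEquivPiSubtypeProd_apply] at h
        exact h
    -- slices
    have hr : ∀ (j : Fin (2 * L - 1)) (e : Edge 3 L), frobNorm ((((glue w e)⁻¹ * r j e : SU2) : Matrix (Fin 2) (Fin 2) ℂ) - 1) ≤ t₂ :=
      fun j e => (Set.mem_univ_pi.1 ((Set.mem_univ_pi.1 hBx) j)) e
    -- seam
    have hg : ∀ x, frobNorm ((((g 0)⁻¹ * g x : SU2) : Matrix (Fin 2) (Fin 2) ℂ) - 1) ≤ t₂ := by
      intro x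
      by_cases hx0 : x = 0
      · subst hx0; rw [inv_mul_cancel]; simp [frobNorm_zero, ht₂]
      · exact (Set.mem_univ_pi.1 hCR) ⟨x, fun h => hx0 ((hpC x).1 h)⟩
    exact ringDeficit_le_of_commBox ht₂ hs w r g hCC hcC hw hr hg
  /- (3) assemble in real numbers -/
  haveI : IsProbabilityMeasure (μA.prod (μB.prod μC)) := by
    rw [hμA, hμB, hμC]; infer_instance
  rw [measureReal_deficit_le_eq_fix]
  calc π4.real E * ballVol t₂ ^ (6 * L ^ 4 - 3)
      = ((μA.prod (μB.prod μC)) P).toReal := by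
        rw [hPmass, ENNReal.toReal_mul, ENNReal.toReal_pow]; rfl
    _ ≤ _ := by
        rw [← measureReal_def]
        exact measureReal_mono hPsub (measure_ne_top _ _)

end Summit.QuantumFields.YangMills.Theorems.SwapTwistDeficit.PeriodicRingFloor

end
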